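import Literature.NumberTheory.EllipticCurves.ShaRestriction
import Literature.NumberTheory.EllipticCurves.LocalKummerIsotropyTransport
import Literature.NumberTheory.EllipticCurves.SelmerProofs
import HarnessLib

/-!
# Restriction of `n`-Selmer classes along a base change `K → L`: `Sel⁽ⁿ⁾(E/K) → Sel⁽ⁿ⁾(E_L/L)`,
# local conditions and STRICT local conditions preserved (row T-E3g-JOINT, FILE J-C1 — the
# `E[n]`-level twin of `ShaRestriction`'s `resBaseChange`; seat p10 GEN 5)

HONEST FRAMING (cell `b2b-bsdres`, run/shared/lean/b2b/bsd-rank1-residual/, verbatim in every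
file): the goal of the cell is to DELETE the COMBINATION-SHAPED residual classes of the
Birch–Swinnerton-Dyer formula for ALL analytic-rank `≤ 1` elliptic curves over `ℚ` — "full BSD
formula for every rank `≤ 1` curve in class `C`" assembled STRICTLY from published theorems — so
that the rank-`≤ 1` remainder becomes exactly the CONSTRUCTION-SHAPED classes, which are TYPED
(missing-input `Prop`s), NOT attempted. This is not "finishing BSD". Team n1011 (N10/N11, the
Route-G LOWER budget node): research route; TOOL theorems; nothing is booked by this file; no mark
/ label moved. No named fact, no `sorry`; ONE bookkeeping definition (`resBaseChangeTorsion`, the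
restriction map itself, as `ShaRestriction.resBaseChange`).

## What (r2 ST-21.2 'JOINT-n', the located seam 'T-res[p]')

`ShaRestriction` proved, for a `K`-field `L` and the base change `E_L`: the restriction
`H¹(K, E) → H¹(L, E_L)` (`resBaseChange`) respects the local kernels
(`mem_localRestrictionKer_iff_resBaseChange_mem`, `localRestrictionKer_le_of_tower`) and maps
`Ш(E/K)` to `Ш(E_L/L)`.  THIS FILE is the same for the coefficients `E[n]`:

* §1 `selmerLocalKer_le_of_tower` — for `K`-fields `E → E'`, a class of `H¹(K, E[n])` satisfying
  the local Selmer condition at `E` satisfies it at `E'`;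
* §2 `resBaseChangeTorsion W L n : H¹(K, E[n]) →+ H¹(L, E_L[n])` (restriction to `Γ_L`, then the
  torsion comparison `E[n](K̄)|_{Γ_L} ≃ E_L[n](L̄)`, `torsionTransferEquiv`) and
  `mem_selmerLocalKer_iff_resBaseChangeTorsion_mem` — the local Selmer condition at an `L`-field
  `E'` CORRESPONDS under it;
* §3 `res_resBaseChangeTorsion_eq_zero` — STRICT local conditions persist: if `c` restricts to
  zero in `H¹(E, E[n])` then `resBaseChangeTorsion c` restricts to zero in `H¹(E', E_L[n])` for
  every `L`-field `E'` over `E`.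

References: J.-P. Serre, *Galois Cohomology* I.§2.4, II.§1.1; J. H. Silverman, *AEC* X.§4;
J. S. Milne, *ADT* I.§6 [MilneADT2006].
-/

noncomputable section

open scoped Classical
open Field Literature.NumberTheory.EllipticCurves Literature.NumberTheory.GaloisRepresentations

universe u

namespace WeierstrassCurve

/-! ### §1 The local Selmer condition grows along a tower -/

section Tower

variable {K : Type u} [Field K] {E : Type u} [Field E] [Algebra K E]
variable {E' : Type u} [Field E'] [Algebra K E'] [Algebra E E'] [IsScalarTower K E E']
variable (W : WeierstrassCurve K) (n : ℤ)

/-- **Local Selmer kernels grow along a tower.** For `K`-fields `E → E'` (compatibly with `K`), a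
class of `H¹(K, E[n])` that dies in `H¹(E, E)` dies in `H¹(E', E)` (the `E[n]`-coefficient twin of
`localRestrictionKer_le_of_tower`: transitivity of restriction `resGalOfEmb_comp_tower` /
`resH1Hom_comp`, embedding independence `selmerLocalKer_eq_of_algHom_holds`).  Applied with
`E = K_v`, `E' = L_w` for a place `w ∣ v`. [folklore] -/
theorem selmerLocalKer_le_of_tower : selmerLocalKer W E n ≤ selmerLocalKer W E' n := by
  intro c hc
  let ι₁ : AlgebraicClosure K →ₐ[K] AlgebraicClosure E := closureEmb (K := K) E
  let ι₂ : AlgebraicClosure E →ₐ[E] AlgebraicClosure E' := closureEmb (K := E) E'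
  rw [← selmerLocalKer_eq_of_algHom_holds W E' ((ι₂.restrictScalars K).comp ι₁) n]
  change c ∈ resKer (resGalOfEmb ((ι₂.restrictScalars K).comp ι₁))
    ((pointsMapOfEmb W ((ι₂.restrictScalars K).comp ι₁)).comp (geomTorsion W n).subtype) _
  rw [resKer_eq_ker, AddMonoidHom.mem_ker,
    resH1Hom_congr (resGalOfEmb_comp_tower ι₁ ι₂)
      (show (pointsMapOfEmb W ((ι₂.restrictScalars K).comp ι₁)).comp (geomTorsion W n).subtype =
          (pointsMapTower W ι₂).comp ((pointsMapOfEmb W ι₁).comp (geomTorsion W n).subtype) by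
        rw [pointsMapOfEmb_comp_tower W ι₁ ι₂]; rfl) _
      (fun x m ↦ by
        simp only [ContinuousMonoidHom.comp_toFun, AddMonoidHom.coe_comp, Function.comp_apply,
          AddSubgroup.coe_subtype, AddSubgroup.torsionBy.coe_smul, pointsMapOfEmb_smul,
          pointsMapTower_smul]),
    ← resH1Hom_comp (resGalOfEmb ι₁) ((pointsMapOfEmb W ι₁).comp (geomTorsion W n).subtype)
      (fun σ P ↦ by
        simp only [AddMonoidHom.coe_comp, AddSubgroup.coe_subtype, Function.comp_apply,
          AddSubgroup.torsionBy.coe_smul]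
        exact pointsMapOfEmb_smul W ι₁ σ P)
      (resGalOfEmb (K := E) ι₂) _ (pointsMapTower_smul W ι₂), AddMonoidHom.comp_apply]
  have h0 : resH1Hom (resGalOfEmb ι₁) ((pointsMapOfEmb W ι₁).comp (geomTorsion W n).subtype)
      (fun σ P ↦ by
        simp only [AddMonoidHom.coe_comp, AddSubgroup.coe_subtype, Function.comp_apply,
          AddSubgroup.torsionBy.coe_smul]
        exact pointsMapOfEmb_smul W ι₁ σ P) c = 0 := hc
  rw [h0, map_zero]

end Tower

/-! ### §2 Restriction to `L` on `H¹(K, E[n])` and the correspondence of local conditions -/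

section BaseChange

variable {K : Type u} [Field K] [CharZero K] (W : WeierstrassCurve K) [W.IsElliptic]
  (L : Type u) [Field L] [Algebra K L] {n : ℤ} (hn : n ≠ 0)

/-- **Restriction to `L` on `n`-torsion coefficients**: `H¹(K, E[n]) → H¹(L, E_L[n])`, `E_L` the
base change of `E` to the `K`-field `L` — restriction to `Γ_L` (`resGal`) together with the torsion
comparison `E[n](K̄) ≃ E_L[n](L̄)` (`torsionTransferEquiv`, `Γ_L`-equivariant); the `E[n]`-twin
of `ShaRestriction.resBaseChange`. Serre, *Galois Cohomology*, I.§2.4. [folklore] -/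
def resBaseChangeTorsion : galH1Torsion W n →+ galH1Torsion (W.baseChange L) n :=
  resH1Hom (resGal (K := K) L)
    ((W.torsionTransferEquiv (E := L) hn : geomTorsion W n ≃+ geomTorsion (W.baseChange L) n) :
      geomTorsion W n →+ geomTorsion (W.baseChange L) n)
    (fun σ T ↦ W.torsionTransferEquiv_smul (E := L) hn σ T)

omit [CharZero K] [W.IsElliptic] in
/-- `baseChangeGeomPointsEquiv⁻¹` is `pointsCongr` at `Ω = L̄` (both are the identity on
coordinates). [folklore] -/
theorem baseChangeGeomPointsEquiv_symm_apply (P : localPoints W L) :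
    (W.baseChangeGeomPointsEquiv L).symm P = pointsCongr W L (AlgebraicClosure L) P := by
  apply (W.baseChangeGeomPointsEquiv L).injective
  rw [AddEquiv.apply_symm_apply]
  rcases P with _ | ⟨x, y, h⟩ <;> rfl

variable {L}
variable {E' : Type u} [Field E'] [Algebra K E'] [Algebra L E'] [IsScalarTower K L E']

/-- **Local Selmer conditions correspond under restriction to `L`.** For an `L`-field `E'` (a
completion `L_w`), a class `c ∈ H¹(K, E[n])` dies in `H¹(E', E)` iff `resBaseChangeTorsion c ∈
H¹(L, E_L[n])` dies in `H¹(E', E_L)`: both are the vanishing of `c` under `Γ_{E'} → Γ_L → Γ_K`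
with coefficients pushed to `E(Ē')` (`resGalOfEmb_comp_tower`, `resH1Hom_comp`, embedding
independence `selmerLocalKer_eq_of_algHom_holds`), up to the identification of coefficients
`E(Ē') = E_L(Ē')` (`pointsCongr`, `mem_resKer_iff_h1Equiv_mem`); the `E[n]`-twin of
`mem_localRestrictionKer_iff_resBaseChange_mem`. Milne, *ADT*, I.§6. [folklore] -/
theorem mem_selmerLocalKer_iff_resBaseChangeTorsion_mem (c : galH1Torsion W n) :
    c ∈ selmerLocalKer W E' n ↔
      resBaseChangeTorsion W L hn c ∈ selmerLocalKer (W.baseChange L) E' n := by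
  let ιL : AlgebraicClosure K →ₐ[K] AlgebraicClosure L := closureEmb (K := K) L
  let ι₃ : AlgebraicClosure L →ₐ[L] AlgebraicClosure E' := closureEmb (K := L) E'
  -- the two compatible pairs along `Γ_{E'} → Γ_L → Γ_K`
  have hψ₁ : ∀ (x : absoluteGaloisGroup E') (m : geomTorsion W n),
      ((pointsMapTower W ι₃).comp ((pointsMapOfEmb W ιL).comp (geomTorsion W n).subtype))
          (((resGalOfEmb ιL).comp (resGalOfEmb (K := L) ι₃)) x • m) =
        x • ((pointsMapTower W ι₃).comp ((pointsMapOfEmb W ιL).comp (geomTorsion W n).subtype))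
          m := fun x m ↦ by
    simp only [ContinuousMonoidHom.comp_toFun, AddMonoidHom.coe_comp, Function.comp_apply,
      AddSubgroup.coe_subtype, AddSubgroup.torsionBy.coe_smul, pointsMapOfEmb_smul,
      pointsMapTower_smul]
  have hψ₂ : ∀ (x : absoluteGaloisGroup E') (m : geomTorsion W n),
      (((pointsMapOfEmb (W.baseChange L) ι₃).comp (geomTorsion (W.baseChange L) n).subtype).comp
          ((W.torsionTransferEquiv (E := L) hn : geomTorsion W n ≃+ geomTorsion (W.baseChange L) n) :
            geomTorsion W n →+ geomTorsion (W.baseChange L) n))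
          (((resGalOfEmb ιL).comp (resGalOfEmb (K := L) ι₃)) x • m) =
        x • (((pointsMapOfEmb (W.baseChange L) ι₃).comp
          (geomTorsion (W.baseChange L) n).subtype).comp
          ((W.torsionTransferEquiv (E := L) hn : geomTorsion W n ≃+ geomTorsion (W.baseChange L) n) :
            geomTorsion W n →+ geomTorsion (W.baseChange L) n)) m := fun x m ↦ by
    simp only [ContinuousMonoidHom.comp_toFun, AddMonoidHom.coe_comp, Function.comp_apply,
      AddSubgroup.coe_subtype, AddMonoidHom.coe_coe]
    have h1 : W.torsionTransferEquiv (E := L) hn ((resGalOfEmb ιL) ((resGalOfEmb (K := L) ι₃) x) • m) =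
        (resGalOfEmb (K := L) ι₃) x • W.torsionTransferEquiv (E := L) hn m :=
      W.torsionTransferEquiv_smul (E := L) hn _ m
    rw [h1, AddSubgroup.torsionBy.coe_smul]
    exact pointsMapOfEmb_smul (W.baseChange L) ι₃ x _
  -- LHS: rewrite along the composite embedding and split
  have hL : c ∈ selmerLocalKer W E' n ↔
      resH1Hom ((resGalOfEmb ιL).comp (resGalOfEmb (K := L) ι₃))
        ((pointsMapTower W ι₃).comp ((pointsMapOfEmb W ιL).comp (geomTorsion W n).subtype)) hψ₁
          c = 0 := by
    rw [← selmerLocalKer_eq_of_algHom_holds W E' ((ι₃.restrictScalars K).comp ιL) n]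
    change c ∈ resKer (resGalOfEmb ((ι₃.restrictScalars K).comp ιL))
      ((pointsMapOfEmb W ((ι₃.restrictScalars K).comp ιL)).comp (geomTorsion W n).subtype) _ ↔ _
    rw [resKer_eq_ker, AddMonoidHom.mem_ker,
      resH1Hom_congr (resGalOfEmb_comp_tower ιL ι₃)
        (show (pointsMapOfEmb W ((ι₃.restrictScalars K).comp ιL)).comp (geomTorsion W n).subtype =
            (pointsMapTower W ι₃).comp ((pointsMapOfEmb W ιL).comp (geomTorsion W n).subtype) by
          rw [pointsMapOfEmb_comp_tower W ιL ι₃]; rfl) _ hψ₁]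
  -- RHS: unfold and compose
  have hR : resBaseChangeTorsion W L hn c ∈ selmerLocalKer (W.baseChange L) E' n ↔
      resH1Hom ((resGalOfEmb ιL).comp (resGalOfEmb (K := L) ι₃))
        (((pointsMapOfEmb (W.baseChange L) ι₃).comp (geomTorsion (W.baseChange L) n).subtype).comp
          ((W.torsionTransferEquiv (E := L) hn : geomTorsion W n ≃+ geomTorsion (W.baseChange L) n) :
            geomTorsion W n →+ geomTorsion (W.baseChange L) n)) hψ₂ c = 0 := by
    change resH1Hom (resGal (K := L) E') ((pointsMap (W.baseChange L) E').comp
        (geomTorsion (W.baseChange L) n).subtype) _ (resH1Hom (resGal (K := K) L) _ _ c) = 0 ↔ _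
    rw [resH1Hom_resH1Hom]
    rfl
  rw [hL, hR]
  -- the two pairs differ by the coefficient identification `pointsCongr`
  have key := mem_resKer_iff_h1Equiv_mem
    ((resGalOfEmb ιL).comp (resGalOfEmb (K := L) ι₃))
    ((pointsMapTower W ι₃).comp ((pointsMapOfEmb W ιL).comp (geomTorsion W n).subtype)) hψ₁
    (((pointsMapOfEmb (W.baseChange L) ι₃).comp (geomTorsion (W.baseChange L) n).subtype).comp
      ((W.torsionTransferEquiv (E := L) hn : geomTorsion W n ≃+ geomTorsion (W.baseChange L) n) :
        geomTorsion W n →+ geomTorsion (W.baseChange L) n)) hψ₂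
    (AddEquiv.refl (geomTorsion W n)) (fun _ _ ↦ rfl)
    (pointsCongr W L (AlgebraicClosure E')) (fun σ P ↦ by
      rw [localPoints.smul_def, localPoints.smul_def]
      exact pointsCongr_map W L
        ((AlgEquiv.restrictScalars L
          (show AlgebraicClosure E' ≃ₐ[E'] AlgebraicClosure E' from σ)) :
            AlgebraicClosure E' →ₐ[L] AlgebraicClosure E') P)
    (fun m ↦ by
      simp only [AddMonoidHom.coe_comp, Function.comp_apply, AddSubgroup.coe_subtype,
        AddMonoidHom.coe_coe, AddEquiv.refl_apply]
      rw [W.coe_torsionTransferEquiv_apply (E := L) hn, baseChangeGeomPointsEquiv_symm_apply]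
      exact (pointsCongr_map W L ι₃ _).symm) c
  rw [resKer_eq_ker, resKer_eq_ker, AddMonoidHom.mem_ker, AddMonoidHom.mem_ker] at key
  rw [key]
  -- `h1Equiv (refl)` is the identity
  have hid : h1Equiv (AddEquiv.refl (geomTorsion W n)) (fun _ _ ↦ rfl) c = c := by
    rw [h1Equiv_apply]
    exact congrArg (fun f : galH1Torsion W n →+ galH1Torsion W n ↦ f c) resH1Hom_id
  rw [hid]

end BaseChange

/-! ### §3 Selmer classes restrict to Selmer classes -/

section Selmer

open NumberField IsDedekindDomain

variable {K : Type u} [Field K] [NumberField K] (W : WeierstrassCurve K) [W.IsElliptic]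
  (L : Type u) [Field L] [NumberField L] [Algebra K L] {n : ℤ} (hn : n ≠ 0)

/-- **Restriction maps `Sel⁽ⁿ⁾(E/K)` into `Sel⁽ⁿ⁾(E_L/L)`** (Kummer Selmer structures): if
`c ∈ H¹(K, E[n])` satisfies the local Selmer condition at every place of `K` then
`resBaseChangeTorsion c ∈ H¹(L, E_L[n])` satisfies it at every place `w` of `L` — with `v` the
place of `K` below `w` and `K_v → L_w` the induced map of completions, the condition at `K_v`
gives the one at `L_w` (`selmerLocalKer_le_of_tower`), which is the condition for the restricted
class (`mem_selmerLocalKer_iff_resBaseChangeTorsion_mem`); the `E[n]`-twin of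
`resBaseChange_mem_sha`. Milne, *ADT*, I.§6; Darmon (2004), §3.9. [folklore] -/
theorem resBaseChangeTorsion_mem_selmerGroup [(W.baseChange L).IsElliptic] {c : galH1Torsion W n}
    (hc : c ∈ (W.kummerSelmerStructure n).selmerGroup) :
    resBaseChangeTorsion W L hn c ∈ ((W.baseChange L).kummerSelmerStructure n).selmerGroup := by
  have hcK : ∀ v : Place K, c ∈ selmerLocalKer W (Place.Completion v) n := fun v ↦ by
    have h : c ∈ ((W.kummerSelmerStructure n) v).comap
        (galoisCohomology.localization (W.torsionGaloisModule n) v 1) :=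
      ((W.kummerSelmerStructure n).mem_selmerGroup_iff c).mp hc v
    rwa [comap_localization_kummerSelmerStructure] at h
  refine (((W.baseChange L).kummerSelmerStructure n).mem_selmerGroup_iff _).mpr fun w ↦ ?_
  suffices h : resBaseChangeTorsion W L hn c ∈
      selmerLocalKer (W.baseChange L) (Place.Completion w) n by
    have h' := h
    rw [← comap_localization_kummerSelmerStructure] at h'
    exact h'
  rcases w with w | w
  · -- infinite places: `w ∣ v := w ∘ (K → L)`
    change resBaseChangeTorsion W L hn c ∈ selmerLocalKer (W.baseChange L) w.Completion n
    let v : InfinitePlace K := w.comap (algebraMap K L)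
    haveI : w.1.LiesOver v.1 := ⟨rfl⟩
    haveI : IsScalarTower K L w.Completion := IsScalarTower.of_algebraMap_eq fun x ↦ by
      apply NumberField.InfinitePlace.Completion.ext
      rw [NumberField.InfinitePlace.Completion.algebraMap_toCompletion,
        NumberField.InfinitePlace.Completion.algebraMap_toCompletion,
        UniformSpace.Completion.algebraMap_def, UniformSpace.Completion.algebraMap_def,
        IsScalarTower.algebraMap_apply K L (WithAbs w.1)]
    letI : Algebra v.Completion w.Completion := NumberField.LiesOver.instAlgebraCompletion
    haveI : IsScalarTower K v.Completion w.Completion :=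
      NumberField.LiesOver.instIsScalarTowerCompletion
    have hv : c ∈ selmerLocalKer W v.Completion n := hcK (Sum.inl v)
    exact (mem_selmerLocalKer_iff_resBaseChangeTorsion_mem W hn c).mp
      (selmerLocalKer_le_of_tower W n (E := v.Completion) hv)
  · -- finite places: `w ∣ v := w ∩ 𝓞 K`
    change resBaseChangeTorsion W L hn c ∈ selmerLocalKer (W.baseChange L) (w.adicCompletion L) n
    let v : HeightOneSpectrum (𝓞 K) := w.under (𝓞 K)
    haveI : w.asIdeal.LiesOver v.asIdeal := ⟨rfl⟩
    letI : Algebra (v.adicCompletion K) (w.adicCompletion L) :=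
      (adicCompletionMap (K := K) L v w).toAlgebra
    haveI : IsScalarTower K (v.adicCompletion K) (w.adicCompletion L) :=
      IsScalarTower.of_algebraMap_eq fun x ↦ (adicCompletionMap_coe (K := K) L v w x).symm
    have hv : c ∈ selmerLocalKer W (v.adicCompletion K) n := hcK (Sum.inr v)
    exact (mem_selmerLocalKer_iff_resBaseChangeTorsion_mem W hn c).mp
      (selmerLocalKer_le_of_tower W n (E := v.adicCompletion K) hv)

end Selmer

/-! ### §4 STRICT local conditions persist -/

section Strict

open NumberField IsDedekindDomain

variable {K : Type u} [Field K] [NumberField K] (W : WeierstrassCurve K) [W.IsElliptic]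
  (L : Type u) [Field L] [NumberField L] [Algebra K L] {n : ℤ} (hn : n ≠ 0)

/-- A crossed homomorphism principal on a subgroup is principal on its conjugates: if
`φ s = s • a − a` for `s` in the image of `θ`, then `φ (g⁻¹ θ(·) g)` is principal with the element
`g⁻¹ • (a + φ g)`. Serre, *Galois Cohomology*, I.§5.1 / *Corps locaux* VII.§5. [folklore] -/
theorem principal_conj_of_principal {G : Type u} [Group G] [TopologicalSpace G]
    [IsTopologicalGroup G] {M : Type u} [AddCommGroup M] [DistribMulAction G M]
    [TopologicalSpace M] [DiscreteTopology M]
    (φ : contOneCocycles (discreteTopRep G M)) (g s : G) (a : M) (hs : φ.1 s = s • a - a) :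
    φ.1 (g⁻¹ * s * g) = (g⁻¹ * s * g) • (g⁻¹ • (a + φ.1 g)) - g⁻¹ • (a + φ.1 g) := by
  have hmul : ∀ x y : G, φ.1 (x * y) = φ.1 x + x • φ.1 y := fun x y ↦ by
    rw [φ.2 x y, discreteTopRep_ρ_apply]
  have hinv : φ.1 g⁻¹ = -(g⁻¹ • φ.1 g) := by
    have h := hmul g⁻¹ g
    rw [inv_mul_cancel, contOneCocycles.apply_one] at h
    exact (neg_eq_of_add_eq_zero_left h.symm).symm
  simp only [hmul, hinv, hs, smul_sub, smul_add, mul_smul, smul_inv_smul]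
  abel

/-- **STRICT local conditions persist under restriction to `L`.** For finite places `w ∣ v`
(`w` of `L` above `v` of `K`) and a class `c ∈ H¹(K, E[n])` whose localisation at `v` vanishes
(in `H¹(K_v, E[n])`), the localisation at `w` of `resBaseChangeTorsion c ∈ H¹(L, E_L[n])` vanishes
(in `H¹(L_w, E_L[n])`): the image of `Γ_{L_w}` in `Γ_K` through `Γ_L` is conjugate to a subgroup
of the image of `Γ_{K_v}` (two `K`-embeddings `K̄ → \bar{L_w}`, `exists_algHom_eq_comp`,
`resGalOfEmb_comp`, `resGalOfEmb_comp_tower`), and a crossed homomorphism principal on a subgroup is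
principal on its conjugates. Serre, *Galois Cohomology*, I.§2.4, II.§1.1. [folklore] -/
theorem localization_resBaseChangeTorsion_eq_zero {v : HeightOneSpectrum (𝓞 K)}
    {w : HeightOneSpectrum (𝓞 L)} (hw : w.under (𝓞 K) = v) {c : galH1Torsion W n}
    (hc : galoisCohomology.localization (W.torsionGaloisModule n) (Sum.inr v) 1 c = 0) :
    galoisCohomology.localization ((W.baseChange L).torsionGaloisModule n) (Sum.inr w) 1
      (resBaseChangeTorsion W L hn c) = 0 := by
  -- the tower `K → K_v → L_w`
  haveI : w.asIdeal.LiesOver v.asIdeal := ⟨by rw [← hw]; rfl⟩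
  letI : Algebra (v.adicCompletion K) (w.adicCompletion L) :=
    (adicCompletionMap (K := K) L v w).toAlgebra
  haveI : IsScalarTower K (v.adicCompletion K) (w.adicCompletion L) :=
    IsScalarTower.of_algebraMap_eq fun x ↦ (adicCompletionMap_coe (K := K) L v w x).symm
  -- the two embeddings `K̄ → \bar{L_w}` and the conjugating element
  let ιL : AlgebraicClosure K →ₐ[K] AlgebraicClosure L := closureEmb (K := K) L
  let ι₃ : AlgebraicClosure L →ₐ[L] AlgebraicClosure (w.adicCompletion L) :=
    closureEmb (K := L) (w.adicCompletion L)
  let ιv : AlgebraicClosure K →ₐ[K] AlgebraicClosure (v.adicCompletion K) :=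
    closureEmb (K := K) (v.adicCompletion K)
  let ι₂ : AlgebraicClosure (v.adicCompletion K) →ₐ[v.adicCompletion K]
      AlgebraicClosure (w.adicCompletion L) := closureEmb (K := v.adicCompletion K) (w.adicCompletion L)
  obtain ⟨g, hg⟩ := exists_algHom_eq_comp ((ι₂.restrictScalars K).comp ιv) ((ι₃.restrictScalars K).comp ιL)
  have key : ∀ τ : absoluteGaloisGroup (w.adicCompletion L),
      resGal (K := K) L (resGal (K := L) (w.adicCompletion L) τ) =
        (show absoluteGaloisGroup K from g)⁻¹ *
          resGal (K := K) (v.adicCompletion K) (resGal (K := v.adicCompletion K) (w.adicCompletion L) τ) *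
          (show absoluteGaloisGroup K from g) := fun τ ↦ by
    have h1 : resGal (K := K) L (resGal (K := L) (w.adicCompletion L) τ) =
        resGalOfEmb ((ι₃.restrictScalars K).comp ιL) τ := by
      rw [resGalOfEmb_comp_tower ιL ι₃]; rfl
    have h2 : resGal (K := K) (v.adicCompletion K)
          (resGal (K := v.adicCompletion K) (w.adicCompletion L) τ) =
        resGalOfEmb ((ι₂.restrictScalars K).comp ιv) τ := by
      rw [resGalOfEmb_comp_tower ιv ι₂]; rfl
    rw [h1, h2, hg, resGalOfEmb_comp]
    rfl
  -- the class as a cocycle; `loc_v c = 0` makes it principal on `Γ_{K_v}`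
  obtain ⟨φ, rfl⟩ :=
    oneCocycleClass_surjective (discreteTopRep (absoluteGaloisGroup K) (geomTorsion W n)) c
  change galoisCohomology.res (W.torsionGaloisModule n) (v.adicCompletion K) 1 _ = 0 at hc
  rw [res_torsionGaloisModule_oneCocycleClass] at hc
  obtain ⟨a, ha⟩ := (oneCocycleClass_eq_zero_iff _ _).mp hc
  have ha' : ∀ σ : absoluteGaloisGroup (v.adicCompletion K),
      φ.1 (resGal (K := K) (v.adicCompletion K) σ) =
        resGal (K := K) (v.adicCompletion K) σ • a - a := fun σ ↦ ha σ
  -- the restricted class as a cocycle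
  have hres : resBaseChangeTorsion W L hn
        (oneCocycleClass (discreteTopRep (absoluteGaloisGroup K) (geomTorsion W n)) φ) =
      oneCocycleClass (discreteTopRep (absoluteGaloisGroup L) (geomTorsion (W.baseChange L) n))
        (contOneCocycles.pullback (resGal (K := K) L)
          (resHomOfEquivariant (resGal (K := K) L)
            ((W.torsionTransferEquiv (E := L) hn :
                geomTorsion W n ≃+ geomTorsion (W.baseChange L) n) :
              geomTorsion W n →+ geomTorsion (W.baseChange L) n)
            (fun σ T ↦ W.torsionTransferEquiv_smul (E := L) hn σ T)) φ) :=
    map_oneCocycleClass _ _ _ φ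
  change galoisCohomology.res ((W.baseChange L).torsionGaloisModule n) (w.adicCompletion L) 1
    (resBaseChangeTorsion W L hn _) = 0
  rw [hres, res_torsionGaloisModule_oneCocycleClass]
  refine (oneCocycleClass_eq_zero_iff _ _).mpr
    ⟨W.torsionTransferEquiv (E := L) hn ((show absoluteGaloisGroup K from g)⁻¹ • (a + φ.1 g)),
    fun τ ↦ ?_⟩
  have hp := principal_conj_of_principal φ (show absoluteGaloisGroup K from g)
    (resGal (K := K) (v.adicCompletion K) (resGal (K := v.adicCompletion K) (w.adicCompletion L) τ))
    a (ha' _)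
  rw [← key] at hp
  change W.torsionTransferEquiv (E := L) hn (φ.1 (resGal (K := K) L
      (resGal (K := L) (w.adicCompletion L) τ))) = _
  rw [hp, map_sub]
  erw [W.torsionTransferEquiv_smul (E := L) hn]
  rfl

end Strict

end WeierstrassCurve

end
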